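import Summits.CriticalPhenomena.PercolationContinuityZ3.Theorems.PercNearOneGluingNoHeavyQuantGluedForestSDEC
import Summits.CriticalPhenomena.PercolationContinuityZ3.Theorems.PercNearOneGluingNoHeavyQuantBinomialToolkit
import HarnessLib

/-!
# QUANT lane R8, T-DEC: IDENTICAL SIBLINGS — the forest law of `k` copies of a gated tree is the BINOMIAL MIXTURE of the convolution powers of its
# sub-forest law, `flaw (replicate k t) = Σ_n C(k,n) qⁿ(1−q)^{k−n}·ρ^{∗n}`, and the residual of the top-level expansion is the same mixture TILTED by
# `a·C(k,n)qⁿ(1−q)^{k−n} − w·C(k,n)(aq)ⁿ(1−aq)^{k−n}` (k-general handles for certificate families; arm-1 gen 49, architect)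

builds on p205010 (kernel theorem, internal audit signed; external expert review pending)

Support + definition file (`--supports stmt-CriticalPhenomena-4575`), QUANT lane seat prim-quant-arm-1 (gen 49, architect), rung R8 of
`run/shared/lean/prim/quant/LADDER.md`; memo `run/shared/lean/prim/quant/prim-quant-arm-1-g49/ARCH-G49.md` §8.  One definition (`cpow`, convolution powers of a
count law), theorems with standard axioms, no sorries.  Uses census-1 g7's binomial Pascal split `QuantCensus.DiscountRow.binom_exp_succ`
(`…QuantBinomialToolkit`) and the list binder of `…QuantForestData` / `…QuantRootScaledExpansion` (`flaw`, `ftop`, `Sib.scale`, `resid`).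

WHY.  Every certificate family of the lane for IDENTICAL siblings (the glued lines `(R^A[q](R^B[s]))^k`, identical triples of chains / brooms, the census
engines' 'tilt formula') reads the forest law and the residual `R_a` of README V428's top-level expansion through the number `n` of reached roots.  This file
puts that reading in the kernel, k-generally and for ANY sub-forest law `ρ` on `{0..M}`:
* `cpow M ρ n` — the `n`-fold convolution power `ρ^{∗n}` on `{0..n·M}` (`cpow_zero`, `cpow_succ`), its law facts `cpow_laws` (nonnegative, vanishing above
  `n·M`, mass `1`, mean `n·mean ρ`);
* **`flaw_replicate_binomial`**: `flaw (replicate k t) h = Σ_{n ≤ k} C(k,n)·qⁿ(1−q)^{k−n}·cpow M ρ n h` (`t = gate ρ q` as `Sib` data; induction on `k` with the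
  Pascal split — the `(k+1)`-st sibling is reached with probability `q`);
* **`resid_replicate_binomial`**: for every weight `w < 1`,
  `resid a w (replicate k t) h = ((1−a)·δ₀ h + Σ_{n ≤ k} (a·C(k,n)qⁿ(1−q)^{k−n} − w·C(k,n)(aq)ⁿ(1−aq)^{k−n})·cpow M ρ n h)/(1 − w)` (the scaled list is
  `replicate k (t.scale a)`, root gate `a·q`, same `ρ`);
* `wco_replicate`: at the canonical weight, `wco a (replicate k t) = rfac a t ^ (k − 1)` (`k ≥ 1`), with `rfac a t · (1 − a q) = 1 − q`; so for `1 ≤ n ≤ k`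
  the `n`-th coefficient is `a·C(k,n)qⁿ(1−q)^{k−n}·(1 − (a·rfac)^{n−1})` (`tilt_coeff`: the TILT FORMULA — the residual is the forest's own binomial
  mixture tilted toward many reached roots, no singleton term) and the zero coefficient is `(1 − a)(1 − (1−q)^{k−1})`.

HONEST STATUS: bookkeeping identities (no DEC content); `ResidDEC`, `SiblingStep`, `GateStepN`, `FarTreeRow` OPEN; RATE class log\* / honest sentence of
`run/shared/lean/prim/quant/README.md` unchanged.  [this work]; Pascal split: prim-quant-census-1 g7; expansion/residual: prim-quant-arm-1 g48.  Nothing here is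
cited as a published result.  The gluing rows served [cite: KozmaNitzan2024, Conjecture 3 (p. 15)]; product measure [cite: Grimmett1999, §1.3 p. 10].
-/

noncomputable section

open scoped BigOperators

namespace Summit.CriticalPhenomena.PercolationContinuityZ3.Theorems
namespace Quant
namespace LawDec

open Finset

/-! ### Convolution powers -/

/-- **convolution powers** of a count law `ρ` on `{0..M}`: `cpow M ρ n = ρ^{∗n}`, a law on `{0..n·M}` (`ρ^{∗0} = δ₀`). [this work] -/
def cpow (M : ℕ) (ρ : ℕ → ℝ) : ℕ → ℕ → ℝ
  | 0 => fun h => if h = 0 then (1 : ℝ) else 0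
  | n + 1 => lconv (n * M) M (cpow M ρ n) ρ

/-- `ρ^{∗0} = δ₀`. [this work] -/
theorem cpow_zero (M : ℕ) (ρ : ℕ → ℝ) : cpow M ρ 0 = fun h => if h = 0 then (1 : ℝ) else 0 := rfl

/-- `ρ^{∗(n+1)} = ρ^{∗n} ∗ ρ`. [this work] -/
theorem cpow_succ (M : ℕ) (ρ : ℕ → ℝ) (n : ℕ) : cpow M ρ (n + 1) = lconv (n * M) M (cpow M ρ n) ρ := rfl

/-- **law facts of the convolution powers**: for a probability law `ρ` on `{0..M}` with mean `m`, `ρ^{∗n}` is a probability law on `{0..n·M}` with mean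
`n·m`. [this work] -/
theorem cpow_laws (M : ℕ) (ρ : ℕ → ℝ) (hρ0 : ∀ h, 0 ≤ ρ h) (hρM : ∀ h, M < h → ρ h = 0) (hρ1 : ∑ h ∈ Finset.range (M + 1), ρ h = 1) :
    ∀ n : ℕ, (∀ h, 0 ≤ cpow M ρ n h) ∧ (∀ h, n * M < h → cpow M ρ n h = 0) ∧ (∑ h ∈ Finset.range (n * M + 1), cpow M ρ n h = 1) ∧
      (∑ h ∈ Finset.range (n * M + 1), (h : ℝ) * cpow M ρ n h = (n : ℝ) * ∑ h ∈ Finset.range (M + 1), (h : ℝ) * ρ h)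
  | 0 => by
    refine ⟨fun h => ?_, fun h hh => ?_, by simp [cpow], by simp [cpow]⟩
    · simp only [cpow]; split_ifs <;> norm_num
    · simp only [cpow]; rw [if_neg (by omega)]
  | n + 1 => by
    obtain ⟨c0, cM, c1, cmn⟩ := cpow_laws M ρ hρ0 hρM hρ1 n
    have htop : (n + 1) * M = n * M + M := by ring
    refine ⟨fun h => lconv_nonneg _ _ _ _ c0 hρ0 h, fun h hh => lconv_eq_zero _ _ _ _ h (by rw [htop] at hh; exact hh), ?_, ?_⟩
    · rw [cpow_succ, htop]; exact sum_lconv _ _ _ _ c1 hρ1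
    · rw [cpow_succ, htop, sum_mul_lconv _ _ _ _ c1 hρ1, cmn]; push_cast; ring

/-! ### The binomial expansion of the forest law of identical siblings -/

/-- **THE FOREST LAW OF `k` IDENTICAL SIBLINGS IS THE BINOMIAL MIXTURE OF THE CONVOLUTION POWERS OF THE SUB-FOREST LAW**:
`flaw (replicate k t) h = Σ_{n ≤ k} C(k,n)·qⁿ·(1−q)^{k−n}·ρ^{∗n}(h)` (`n` = number of reached roots). [this work] -/
theorem flaw_replicate_binomial (t : Sib) (ht : t.LawOK) :
    ∀ (k : ℕ) (h : ℕ), flaw (List.replicate k t) h =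
      ∑ n ∈ Finset.range (k + 1), (((Nat.choose k n : ℕ) : ℝ) * t.q ^ n * (1 - t.q) ^ (k - n)) * cpow t.M t.ρ n h
  | 0, h => by simp [flaw, cpow]
  | k + 1, h => by
    have hρ := ht
    obtain ⟨_, _, ρ0, ρM, ρ1⟩ := hρ
    have hL : ∀ s ∈ List.replicate k t, s.LawOK := fun s hs => by rw [List.eq_of_mem_replicate hs]; exact ht
    obtain ⟨_, fM, _, _⟩ := flaw_facts (List.replicate k t) hL
    have ih : flaw (List.replicate k t) = fun i =>
        ∑ n ∈ Finset.range (k + 1), (((Nat.choose k n : ℕ) : ℝ) * t.q ^ n * (1 - t.q) ^ (k - n)) * cpow t.M t.ρ n i :=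
      funext fun i => flaw_replicate_binomial t ht k i
    rw [List.replicate_succ]
    show lconv (ftop (List.replicate k t)) t.M (flaw (List.replicate k t)) (gate t.ρ t.q) h = _
    rw [lconv_gate_right _ _ _ _ _ fM h, ih, lconv_fsum_left]
    -- each power steps up: `ρ^{∗n} ∗ ρ = ρ^{∗(n+1)}` (left top `k·M ≥ n·M`)
    have hstep : ∀ n ∈ Finset.range (k + 1),
        (((Nat.choose k n : ℕ) : ℝ) * t.q ^ n * (1 - t.q) ^ (k - n)) * lconv (ftop (List.replicate k t)) t.M (cpow t.M t.ρ n) t.ρ h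
          = (((Nat.choose k n : ℕ) : ℝ) * t.q ^ n * (1 - t.q) ^ (k - n)) * cpow t.M t.ρ (n + 1) h := by
      intro n hn
      have hnk : n ≤ k := by rw [Finset.mem_range] at hn; omega
      obtain ⟨_, cM, _, _⟩ := cpow_laws t.M t.ρ ρ0 ρM ρ1 n
      rw [ftop_replicate, lconv_top_left_of_le (n * t.M) (k * t.M) t.M _ _ (Nat.mul_le_mul_right _ hnk) cM h, cpow_succ]
    rw [Finset.sum_congr rfl hstep]
    have pascal := QuantCensus.DiscountRow.binom_exp_succ k t.q (fun n => cpow t.M t.ρ n h)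
    rw [show k + 2 = k + 1 + 1 from rfl] at pascal
    rw [pascal]

/-! ### The residual of identical siblings -/

/-- scaling every root gate of a replicated list is replicating the scaled sibling. [this work] -/
theorem map_scale_replicate (a : ℝ) (k : ℕ) (t : Sib) : (List.replicate k t).map (Sib.scale a) = List.replicate k (t.scale a) := by
  rw [List.map_replicate]

/-- **THE RESIDUAL OF `k` IDENTICAL SIBLINGS** at outer gate `0 < a ≤ 1` and any weight `w < 1`:
`resid a w (replicate k t) h = ((1−a)·δ₀ h + Σ_{n ≤ k} (a·C(k,n)qⁿ(1−q)^{k−n} − w·C(k,n)(aq)ⁿ(1−aq)^{k−n})·ρ^{∗n}(h))/(1 − w)`. [this work] -/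
theorem resid_replicate_binomial (t : Sib) (ht : t.LawOK) {a : ℝ} (ha0 : 0 < a) (ha1 : a ≤ 1) (w : ℝ) (k h : ℕ) :
    resid a w (List.replicate k t) h =
      ((1 - a) * (if h = 0 then (1 : ℝ) else 0) +
        ∑ n ∈ Finset.range (k + 1),
          (a * (((Nat.choose k n : ℕ) : ℝ) * t.q ^ n * (1 - t.q) ^ (k - n)) -
            w * (((Nat.choose k n : ℕ) : ℝ) * (a * t.q) ^ n * (1 - a * t.q) ^ (k - n))) * cpow t.M t.ρ n h) / (1 - w) := by
  have hta : (t.scale a).LawOK := Sib.scale_lawOK ha0 ha1 ht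
  simp only [resid]
  rw [map_scale_replicate, gate_apply, flaw_replicate_binomial t ht k h, flaw_replicate_binomial (t.scale a) hta k h]
  simp only [Sib.scale_fields]
  congr 1
  rw [Finset.mul_sum, Finset.mul_sum]
  have e : ∀ n : ℕ,
      (a * (((Nat.choose k n : ℕ) : ℝ) * t.q ^ n * (1 - t.q) ^ (k - n)) -
          w * (((Nat.choose k n : ℕ) : ℝ) * (a * t.q) ^ n * (1 - a * t.q) ^ (k - n))) * cpow t.M t.ρ n h
        = a * ((((Nat.choose k n : ℕ) : ℝ) * t.q ^ n * (1 - t.q) ^ (k - n)) * cpow t.M t.ρ n h) -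
          w * ((((Nat.choose k n : ℕ) : ℝ) * (a * t.q) ^ n * (1 - a * t.q) ^ (k - n)) * cpow t.M t.ρ n h) := fun n => by ring
  simp_rw [e]
  rw [Finset.sum_sub_distrib]
  ring

/-- **the canonical weight of identical siblings**: `wco a (replicate k t) = rfac a t ^ (k − 1)` for `k ≥ 1`. [this work] -/
theorem wco_replicate (a : ℝ) (t : Sib) : ∀ k : ℕ, 1 ≤ k → wco a (List.replicate k t) = rfac a t ^ (k - 1)
  | 0, hk => absurd hk (by omega)
  | 1, _ => by simp [wco]
  | k + 2, _ => by
    have ih := wco_replicate a t (k + 1) (by omega)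
    rw [List.replicate_succ]
    have h := (wco_cons_of_const a t.q (List.replicate (k + 1) t) t (fun u hu => by
      rcases List.mem_cons.1 hu with rfl | hu
      · rfl
      · rw [List.eq_of_mem_replicate hu])).2 (by simp)
    rw [h, ih, show k + 2 - 1 = (k + 1 - 1) + 1 by omega, pow_succ]
    ring

/-- **THE TILT FORMULA for one coefficient** (`1 ≤ n ≤ k`, `0 < q < 1`, `a ≤ 1`): with `r = rfac a t` (`r·(1 − aq) = 1 − q`),
`a·C(k,n)qⁿ(1−q)^{k−n} − r^{k−1}·C(k,n)(aq)ⁿ(1−aq)^{k−n} = a·C(k,n)qⁿ(1−q)^{k−n}·(1 − (a·r)^{n−1})` — the residual's weight on `ρ^{∗n}` is the forest's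
binomial weight scaled by `a(1 − (a r)^{n−1})/(1 − r^{k−1}) ≥ 0`, vanishing on singletons. [this work] -/
theorem tilt_coeff {a : ℝ} (ha1 : a ≤ 1) (t : Sib) (ht : t.LawOK) {k n : ℕ} (hn1 : 1 ≤ n) (hnk : n ≤ k) :
    a * (((Nat.choose k n : ℕ) : ℝ) * t.q ^ n * (1 - t.q) ^ (k - n)) -
        rfac a t ^ (k - 1) * (((Nat.choose k n : ℕ) : ℝ) * (a * t.q) ^ n * (1 - a * t.q) ^ (k - n))
      = a * (((Nat.choose k n : ℕ) : ℝ) * t.q ^ n * (1 - t.q) ^ (k - n)) * (1 - (a * rfac a t) ^ (n - 1)) := by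
  obtain ⟨_, _, hrq, _, _⟩ := rfac_facts ha1 ht
  -- `r^{k−1}·(1−aq)^{k−n} = r^{n−1}·(1−q)^{k−n}` and `(aq)ⁿ = a·aⁿ⁻¹·qⁿ`
  have e1 : rfac a t ^ (k - 1) * (1 - a * t.q) ^ (k - n) = rfac a t ^ (n - 1) * (1 - t.q) ^ (k - n) := by
    rw [show k - 1 = (n - 1) + (k - n) by omega, pow_add, mul_assoc, ← mul_pow, hrq]
  have e2 : (a * t.q) ^ n = a * (a ^ (n - 1) * t.q ^ n) := by
    obtain ⟨m, rfl⟩ : ∃ m, n = m + 1 := ⟨n - 1, (Nat.sub_add_cancel hn1).symm⟩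
    rw [Nat.add_sub_cancel, mul_pow, pow_succ]
    ring
  calc a * (((Nat.choose k n : ℕ) : ℝ) * t.q ^ n * (1 - t.q) ^ (k - n)) -
        rfac a t ^ (k - 1) * (((Nat.choose k n : ℕ) : ℝ) * (a * t.q) ^ n * (1 - a * t.q) ^ (k - n))
      = a * (((Nat.choose k n : ℕ) : ℝ) * t.q ^ n * (1 - t.q) ^ (k - n)) -
          ((Nat.choose k n : ℕ) : ℝ) * (a * t.q) ^ n * (rfac a t ^ (k - 1) * (1 - a * t.q) ^ (k - n)) := by ring
    _ = a * (((Nat.choose k n : ℕ) : ℝ) * t.q ^ n * (1 - t.q) ^ (k - n)) -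
          ((Nat.choose k n : ℕ) : ℝ) * (a * (a ^ (n - 1) * t.q ^ n)) * (rfac a t ^ (n - 1) * (1 - t.q) ^ (k - n)) := by rw [e1, e2]
    _ = a * (((Nat.choose k n : ℕ) : ℝ) * t.q ^ n * (1 - t.q) ^ (k - n)) * (1 - (a * rfac a t) ^ (n - 1)) := by
          rw [mul_pow]; ring

/-- **the zero coefficient at the canonical weight** (`k ≥ 1`): `(1−a) + a(1−q)^k − r^{k−1}(1−aq)^k = (1−a)(1 − (1−q)^{k−1})`. [this work] -/
theorem tilt_coeff_zero {a : ℝ} (ha1 : a ≤ 1) (t : Sib) (ht : t.LawOK) {k : ℕ} (hk : 1 ≤ k) :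
    (1 - a) + (a * (((Nat.choose k 0 : ℕ) : ℝ) * t.q ^ 0 * (1 - t.q) ^ (k - 0)) -
        rfac a t ^ (k - 1) * (((Nat.choose k 0 : ℕ) : ℝ) * (a * t.q) ^ 0 * (1 - a * t.q) ^ (k - 0)))
      = (1 - a) * (1 - (1 - t.q) ^ (k - 1)) := by
  obtain ⟨_, _, hrq, _, _⟩ := rfac_facts ha1 ht
  obtain ⟨m, rfl⟩ : ∃ m, k = m + 1 := ⟨k - 1, (Nat.sub_add_cancel hk).symm⟩
  have e1 : rfac a t ^ (m + 1 - 1) * (1 - a * t.q) ^ (m + 1) = (1 - t.q) ^ m * (1 - a * t.q) := by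
    rw [Nat.add_sub_cancel, pow_succ, ← mul_assoc, ← mul_pow, hrq]
  have e2 : (1 - t.q) ^ (m + 1) = (1 - t.q) ^ m * (1 - t.q) := pow_succ _ _
  simp only [Nat.choose_zero_right, Nat.cast_one, pow_zero, Nat.sub_zero, one_mul, mul_one]
  rw [e1, e2, Nat.add_sub_cancel]
  ring


end LawDec
end Quant
end Summit.CriticalPhenomena.PercolationContinuityZ3.Theorems
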